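import Mathlib
import HarnessLib
import Summits.HubbardSuperconductivity.HubbardSuperconductivity.Theorems.KLProgrammeKLRegimeSplitEdgeFactsRungSecondDiff
import Summits.HubbardSuperconductivity.HubbardSuperconductivity.Theorems.KLProgrammeKLRegimeSplitEdgeFactsCutoffSecondDiff
import Summits.HubbardSuperconductivity.HubbardSuperconductivity.Theorems.KLProgrammeKLRegimeSplitEdgeFactsBandJets

/-!
# Route `KLProgramme` — edge facts for the pair masses ACROSS TRANSFERS, VI: the COMPOSED JET ROWS — closed forms for the first/second differences of the
# rung `ĝ_K(ν,·)`, of the cutoff weight `w^K_Λ(ν,·)` and of the weighted rungs `φ·ĝ_K`, `w_Λ·ĝ_K` at a torus step `Q`, in powers of `|p_Q|_𝕋`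

Cell gate-hubbard-kl, seat hubbard-kl-k3c1-p1 (g21; child-1 lineage; technique: composed-map remainder propagation).  Rows 18 (`…RungSecondDiff`: exact
identities for `δ_Q ĝ`, `δ²_Q ĝ`, product rule for `δ²_Q(φĝ)`), 19 (`…CutoffSecondDiff`: `|δ_Q w_Λ|`, `|δ²_Q w_Λ|` through the cutoff argument `u = (ω² + e_K²)/Λ²`)
and 20 (`…BandJets`: `|δ^±_Q e_K| ≤ v·s`, `|δ²_Q e_K| ≤ κ·s²`, `v = 4 + coeffNorm 1 K`, `κ = 4 + coeffNorm 2 K`, `s = |p_Q|_𝕋 = klTorusNorm L Q`) are COMPOSED here into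
closed forms, given POINTWISE SIZES at the three momenta `p − Q, p, p + Q` (frequency `ν` fixed): `‖ĝ_K(ν,·)‖ ≤ g` and `|e_K(·)| ≤ E`.

* §1 the rung: `‖ĝ(p+Q) − ĝ(p)‖ ≤ v·s·‖ĝ(p+Q)‖‖ĝ(p)‖` (no hypothesis), `‖δ²_Q ĝ(p)‖ ≤ κ s²·‖ĝ₊‖‖ĝ₋‖ + 2v²s²·‖ĝ₊‖‖ĝ‖‖ĝ₋‖`, hence
  **`‖δ²_Q ĝ(p)‖ ≤ (κ + 2v²g)·g²·s²`** under the size `g`;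
* §2 the cutoff weight (`|e_K| ≤ E` at the points involved): **`|w_Λ(p+Q) − w_Λ(p)| ≤ (16/3)·E·v·s/Λ²`**, the backward twin, and
  **`|δ²_Q w_Λ(p)| ≤ ((16/3)(E·κ + v²)/Λ² + (1408/9)·E²v²/Λ⁴)·s²`** (`|χ₂′| ≤ 8/3`, `|χ₂″| ≤ 176/9`);
* §3 a weighted rung `φ·ĝ` with abstract profile sizes `|φ(p−Q)| ≤ Φ₀`, `|φ(p) − φ(p−Q)| ≤ Φ₁`, `|δ²_Qφ(p)| ≤ Φ₂`:
  **`‖δ²_Q(φĝ)(p)‖ ≤ Φ₂·g + 2Φ₁·v·s·g² + Φ₀·(κ + 2v²g)·g²·s²`**;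
* §4 the hard-shell member `φ = w_Λ`: **`‖δ²_Q(w_Λĝ)(p)‖ ≤ C(E, Λ, g, v, κ)·s²** with
  `C = ((16/3)(Eκ + v²)/Λ² + (1408/9)E²v²/Λ⁴)·g + (32/3)(E·v²/Λ²)·g² + (κ + 2v²g)·g²`;
* §5 the complementary member `φ = softSymbolCompl … n m = w_{Λ_m} − w_{Λ_n}`: `|φ| ≤ 1`, its first/second differences and **`‖δ²_Q(φĝ)(p)‖ ≤ C′·s²`**,
  `C′` = the §4 constant with every `Λ`-dependent term summed over `Λ_m, Λ_n`.

Reading for (D2)-deep (row 16 consumes `‖g^a(p)‖·‖δ²_Q g^b(p)‖`): on the scale-`j` supports `g ≲ 1/Λ_j`, `E ≲ Λ_j`, so `C ≲ (κ + v²)/Λ_j³` and every summand of row 16 is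
`O(((κ + v²)/Λ_j³)·‖g^a‖·|p_Q|_𝕋²)` — with `|p_Q|_𝕋 ≤ 4^{-(j+1)}` in the class this is the geometric rate `(|Q|·4^j)²`; what remains E1's is the choice of the sizes
on the supports and the phase-space sum `(βL²)⁻¹Σ_νΣ_p ‖g^a‖ ≲ b`.  Everything is proved; no definitions; nothing asserts any slot, stub, K3 or SC. [folklore]
-/

noncomputable section

namespace Summit.HubbardSuperconductivity.HubbardSuperconductivity.Theorems.KLRegimeSplit

set_option linter.dupNamespace false -- summit = problem name (single-conjunct summit), D-0017

open Real Finset Literature.MathematicalPhysics.QuantumLattice Literature.Probability.LatticeModels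
open Literature.MathematicalPhysics.QuantumLattice.FermiRG
open Summit.HubbardSuperconductivity.HubbardSuperconductivity.Theorems.KLProgrammeLegKernels
open Summit.HubbardSuperconductivity.HubbardSuperconductivity.Theorems.TwoPointAssembly

section Composed

variable {L M : ℕ} [NeZero L] (β μ : ℝ) (K : TrigPolyC4v)

/-! ## §1 The rung `ĝ_K(ν,·)` at a step `Q`: closed forms -/

/-- **First difference of the rung, closed form** (no hypothesis): `‖ĝ(ν,p+Q) − ĝ(ν,p)‖ ≤ (4 + coeffNorm 1 K)·|p_Q|_𝕋·‖ĝ(ν,p+Q)‖·‖ĝ(ν,p)‖`. [folklore] -/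
theorem klrj_norm_propCT_sub_le (hβ : β ≠ 0) (ν : MatsubaraIdx M) (p Q : TorusSite 2 L) :
    ‖propCT L M β μ K (ν, p + Q) - propCT L M β μ K (ν, p)‖ ≤
      (4 + K.coeffNorm 1) * klTorusNorm L Q * (‖propCT L M β μ K (ν, p + Q)‖ * ‖propCT L M β μ K (ν, p)‖) := by
  rw [propCT_sub_propCT_eq μ K hβ ν p Q, norm_mul, norm_neg, Complex.norm_real, Real.norm_eq_abs, norm_mul]
  exact mul_le_mul_of_nonneg_right (klbj_abs_nambuXiCT_add_sub_le μ K p Q) (by positivity)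

/-- **First difference of the rung, backward**: `‖ĝ(ν,p) − ĝ(ν,p−Q)‖ ≤ (4 + coeffNorm 1 K)·|p_Q|_𝕋·‖ĝ(ν,p)‖·‖ĝ(ν,p−Q)‖`. [folklore] -/
theorem klrj_norm_propCT_sub_le' (hβ : β ≠ 0) (ν : MatsubaraIdx M) (p Q : TorusSite 2 L) :
    ‖propCT L M β μ K (ν, p) - propCT L M β μ K (ν, p - Q)‖ ≤
      (4 + K.coeffNorm 1) * klTorusNorm L Q * (‖propCT L M β μ K (ν, p)‖ * ‖propCT L M β μ K (ν, p - Q)‖) := by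
  have h := klrj_norm_propCT_sub_le β μ K hβ ν (p - Q) Q
  rwa [sub_add_cancel] at h

/-- **Second difference of the rung, closed form** (no hypothesis):
`‖δ²_Q ĝ(ν,p)‖ ≤ (4 + coeffNorm 2 K)·s²·‖ĝ₊‖‖ĝ₋‖ + 2(4 + coeffNorm 1 K)²·s²·‖ĝ₊‖‖ĝ‖‖ĝ₋‖`, `s = |p_Q|_𝕋`. [folklore] -/
theorem klrj_norm_propCT_secondDiff_le (hβ : β ≠ 0) (ν : MatsubaraIdx M) (p Q : TorusSite 2 L) :
    ‖propCT L M β μ K (ν, p + Q) - 2 * propCT L M β μ K (ν, p) + propCT L M β μ K (ν, p - Q)‖ ≤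
      (4 + K.coeffNorm 2) * klTorusNorm L Q ^ 2 * (‖propCT L M β μ K (ν, p + Q)‖ * ‖propCT L M β μ K (ν, p - Q)‖) +
        2 * ((4 + K.coeffNorm 1) * klTorusNorm L Q) ^ 2 *
          (‖propCT L M β μ K (ν, p + Q)‖ * ‖propCT L M β μ K (ν, p)‖ * ‖propCT L M β μ K (ν, p - Q)‖) := by
  have h2 : |nambuXiCT L μ K (p + Q) - nambuXiCT L μ K p + (nambuXiCT L μ K (p - Q) - nambuXiCT L μ K p)| ≤
      (4 + K.coeffNorm 2) * klTorusNorm L Q ^ 2 := by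
    rw [show nambuXiCT L μ K (p + Q) - nambuXiCT L μ K p + (nambuXiCT L μ K (p - Q) - nambuXiCT L μ K p) =
      nambuXiCT L μ K (p + Q) - 2 * nambuXiCT L μ K p + nambuXiCT L μ K (p - Q) by ring]
    exact klbj_abs_nambuXiCT_secondDiff_le μ K p Q
  have hp := klbj_abs_nambuXiCT_add_sub_le μ K p Q
  have hm := klbj_abs_nambuXiCT_sub_sub_le μ K p Q
  refine (norm_propCT_secondDiff_le μ K hβ ν p Q).trans (add_le_add ?_ ?_)
  · exact mul_le_mul_of_nonneg_right h2 (by positivity)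
  · have hsq : |nambuXiCT L μ K (p + Q) - nambuXiCT L μ K p| * |nambuXiCT L μ K (p - Q) - nambuXiCT L μ K p| ≤
        ((4 + K.coeffNorm 1) * klTorusNorm L Q) ^ 2 := by
      rw [sq]; exact mul_le_mul hp hm (abs_nonneg _) ((abs_nonneg _).trans hp)
    exact mul_le_mul_of_nonneg_right (mul_le_mul_of_nonneg_left hsq (by norm_num)) (by positivity)

/-- **Second difference of the rung under a uniform size**: `‖ĝ(ν,p′)‖ ≤ g` at `p′ = p−Q, p, p+Q` ⟹
`‖δ²_Q ĝ(ν,p)‖ ≤ ((4 + coeffNorm 2 K) + 2(4 + coeffNorm 1 K)²·g)·g²·|p_Q|_𝕋²`. [folklore] -/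
theorem klrj_norm_propCT_secondDiff_le_of_size (hβ : β ≠ 0) (ν : MatsubaraIdx M) (p Q : TorusSite 2 L) {g : ℝ}
    (hgp : ‖propCT L M β μ K (ν, p + Q)‖ ≤ g) (hg : ‖propCT L M β μ K (ν, p)‖ ≤ g) (hgm : ‖propCT L M β μ K (ν, p - Q)‖ ≤ g) :
    ‖propCT L M β μ K (ν, p + Q) - 2 * propCT L M β μ K (ν, p) + propCT L M β μ K (ν, p - Q)‖ ≤
      ((4 + K.coeffNorm 2) + 2 * (4 + K.coeffNorm 1) ^ 2 * g) * g ^ 2 * klTorusNorm L Q ^ 2 := by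
  have hg0 : 0 ≤ g := (norm_nonneg _).trans hg
  have hv : 0 ≤ 4 + K.coeffNorm 1 := by have := TrigPolyC4v.coeffNorm_nonneg 1 K; linarith
  have hκ : 0 ≤ 4 + K.coeffNorm 2 := by have := TrigPolyC4v.coeffNorm_nonneg 2 K; linarith
  have hs := EngineV8.klband_klTorusNorm_nonneg (L := L) Q
  have h1 : ‖propCT L M β μ K (ν, p + Q)‖ * ‖propCT L M β μ K (ν, p - Q)‖ ≤ g * g :=
    mul_le_mul hgp hgm (norm_nonneg _) hg0
  have h2 : ‖propCT L M β μ K (ν, p + Q)‖ * ‖propCT L M β μ K (ν, p)‖ * ‖propCT L M β μ K (ν, p - Q)‖ ≤ g * g * g :=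
    mul_le_mul (mul_le_mul hgp hg (norm_nonneg _) hg0) hgm (norm_nonneg _) (mul_nonneg hg0 hg0)
  refine (klrj_norm_propCT_secondDiff_le β μ K hβ ν p Q).trans ?_
  have e1 : (4 + K.coeffNorm 2) * klTorusNorm L Q ^ 2 * (‖propCT L M β μ K (ν, p + Q)‖ * ‖propCT L M β μ K (ν, p - Q)‖) ≤
      (4 + K.coeffNorm 2) * klTorusNorm L Q ^ 2 * (g * g) := mul_le_mul_of_nonneg_left h1 (by positivity)
  have e2 : 2 * ((4 + K.coeffNorm 1) * klTorusNorm L Q) ^ 2 *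
      (‖propCT L M β μ K (ν, p + Q)‖ * ‖propCT L M β μ K (ν, p)‖ * ‖propCT L M β μ K (ν, p - Q)‖) ≤
      2 * ((4 + K.coeffNorm 1) * klTorusNorm L Q) ^ 2 * (g * g * g) := mul_le_mul_of_nonneg_left h2 (by positivity)
  have hid : (4 + K.coeffNorm 2) * klTorusNorm L Q ^ 2 * (g * g) + 2 * ((4 + K.coeffNorm 1) * klTorusNorm L Q) ^ 2 * (g * g * g) =
      ((4 + K.coeffNorm 2) + 2 * (4 + K.coeffNorm 1) ^ 2 * g) * g ^ 2 * klTorusNorm L Q ^ 2 := by ring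
  linarith

/-! ## §2 The CT cutoff weight `w^K_Λ(ν,·)` at a step `Q`, given the band size `|e_K| ≤ E` -/

/-- `|δe·(e′ + e)| ≤ (v·s)·(2E)` from `|δe| ≤ v s`, `|e|, |e′| ≤ E`. [folklore] -/
theorem klrj_abs_mul_add_le {d e e' B E : ℝ} (hd : |d| ≤ B) (he : |e| ≤ E) (he' : |e'| ≤ E) : |d * (e' + e)| ≤ B * (2 * E) := by
  rw [abs_mul]
  exact mul_le_mul hd ((abs_add_le _ _).trans (by linarith)) (abs_nonneg _) ((abs_nonneg _).trans hd)

/-- **First difference of the cutoff weight, closed form**: `|e_K(p)|, |e_K(p+Q)| ≤ E` ⟹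
`|w_Λ(ν,p+Q) − w_Λ(ν,p)| ≤ (8/3)·((4 + coeffNorm 1 K)·|p_Q|_𝕋·2E)/Λ²` (`= (16/3)E·v·s/Λ²`). [folklore] -/
theorem klrj_abs_cutoffWeight_sub_le (Λ : ℝ) (ν : MatsubaraIdx M) (p Q : TorusSite 2 L) {E : ℝ} (hEp : |nambuXiCT L μ K (p + Q)| ≤ E)
    (hE : |nambuXiCT L μ K p| ≤ E) :
    |hubbardCutoffWeightCT L M β μ K Λ (ν, p + Q) - hubbardCutoffWeightCT L M β μ K Λ (ν, p)| ≤
      8 / 3 * ((4 + K.coeffNorm 1) * klTorusNorm L Q * (2 * E) / Λ ^ 2) := by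
  refine (abs_hubbardCutoffWeightCT_sub_le β μ K Λ ν p Q).trans (mul_le_mul_of_nonneg_left ?_ (by norm_num))
  rw [abs_div, abs_of_nonneg (sq_nonneg Λ)]
  exact div_le_div_of_nonneg_right (klrj_abs_mul_add_le (klbj_abs_nambuXiCT_add_sub_le μ K p Q) hE hEp) (sq_nonneg _)

/-- **First difference of the cutoff weight, backward**: `|e_K(p)|, |e_K(p−Q)| ≤ E` ⟹ `|w_Λ(ν,p) − w_Λ(ν,p−Q)| ≤ (8/3)·((4 + coeffNorm 1 K)·|p_Q|_𝕋·2E)/Λ²`.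
[folklore] -/
theorem klrj_abs_cutoffWeight_sub_le' (Λ : ℝ) (ν : MatsubaraIdx M) (p Q : TorusSite 2 L) {E : ℝ} (hE : |nambuXiCT L μ K p| ≤ E)
    (hEm : |nambuXiCT L μ K (p - Q)| ≤ E) :
    |hubbardCutoffWeightCT L M β μ K Λ (ν, p) - hubbardCutoffWeightCT L M β μ K Λ (ν, p - Q)| ≤
      8 / 3 * ((4 + K.coeffNorm 1) * klTorusNorm L Q * (2 * E) / Λ ^ 2) := by
  have h := klrj_abs_cutoffWeight_sub_le β μ K Λ ν (p - Q) Q (E := E) (by rwa [sub_add_cancel]) hEm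
  rwa [sub_add_cancel] at h

/-- **Second difference of the cutoff weight, closed form**: `|e_K| ≤ E` at `p−Q, p, p+Q` ⟹
`|δ²_Q w_Λ(ν,p)| ≤ ((16/3)·(E·(4 + coeffNorm 2 K) + (4 + coeffNorm 1 K)²)/Λ² + (1408/9)·E²·(4 + coeffNorm 1 K)²/Λ⁴)·|p_Q|_𝕋²`. [folklore] -/
theorem klrj_abs_cutoffWeight_secondDiff_le (Λ : ℝ) (ν : MatsubaraIdx M) (p Q : TorusSite 2 L) {E : ℝ} (hEp : |nambuXiCT L μ K (p + Q)| ≤ E)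
    (hE : |nambuXiCT L μ K p| ≤ E) (hEm : |nambuXiCT L μ K (p - Q)| ≤ E) :
    |hubbardCutoffWeightCT L M β μ K Λ (ν, p + Q) - 2 * hubbardCutoffWeightCT L M β μ K Λ (ν, p) + hubbardCutoffWeightCT L M β μ K Λ (ν, p - Q)| ≤
      (16 / 3 * (E * (4 + K.coeffNorm 2) + (4 + K.coeffNorm 1) ^ 2) / Λ ^ 2 + 1408 / 9 * E ^ 2 * (4 + K.coeffNorm 1) ^ 2 / Λ ^ 4) *
        klTorusNorm L Q ^ 2 := by
  set v := 4 + K.coeffNorm 1 with hv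
  set κ := 4 + K.coeffNorm 2 with hκ
  set s := klTorusNorm L Q with hs
  set e₂ := nambuXiCT L μ K (p + Q)
  set e₁ := nambuXiCT L μ K p
  set e₀ := nambuXiCT L μ K (p - Q)
  have hE0 : 0 ≤ E := (abs_nonneg _).trans hE
  have hs0 : 0 ≤ s := EngineV8.klband_klTorusNorm_nonneg (L := L) Q
  have hv0 : 0 ≤ v := by have := TrigPolyC4v.coeffNorm_nonneg 1 K; simp only [hv]; linarith
  have hp : |e₂ - e₁| ≤ v * s := klbj_abs_nambuXiCT_add_sub_le μ K p Q
  have hm : |e₀ - e₁| ≤ v * s := klbj_abs_nambuXiCT_sub_sub_le μ K p Q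
  have h2 : |e₂ - 2 * e₁ + e₀| ≤ κ * s ^ 2 := klbj_abs_nambuXiCT_secondDiff_le μ K p Q
  -- the first-order pieces `δ^±u = δ^±e (e^± + e)/Λ²`
  have hup : |(e₂ - e₁) * (e₂ + e₁) / Λ ^ 2| ≤ v * s * (2 * E) / Λ ^ 2 := by
    rw [abs_div, abs_of_nonneg (sq_nonneg Λ)]
    exact div_le_div_of_nonneg_right (klrj_abs_mul_add_le hp hE hEp) (sq_nonneg _)
  have hum : |(e₀ - e₁) * (e₀ + e₁) / Λ ^ 2| ≤ v * s * (2 * E) / Λ ^ 2 := by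
    rw [abs_div, abs_of_nonneg (sq_nonneg Λ)]
    exact div_le_div_of_nonneg_right (klrj_abs_mul_add_le hm hE hEm) (sq_nonneg _)
  -- the second-order piece `δ²u = (2e δ²e + (δ⁺e)² + (δ⁻e)²)/Λ²`
  have hnum : |2 * e₁ * (e₂ - 2 * e₁ + e₀) + (e₂ - e₁) ^ 2 + (e₀ - e₁) ^ 2| ≤ 2 * E * (κ * s ^ 2) + 2 * (v * s) ^ 2 := by
    have t1 : |2 * e₁ * (e₂ - 2 * e₁ + e₀)| ≤ 2 * E * (κ * s ^ 2) := by
      rw [abs_mul, abs_mul, abs_two]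
      exact mul_le_mul (mul_le_mul_of_nonneg_left hE (by norm_num)) h2 (abs_nonneg _) (by positivity)
    have t2 : |(e₂ - e₁) ^ 2| ≤ (v * s) ^ 2 := by rw [abs_pow]; exact pow_le_pow_left₀ (abs_nonneg _) hp 2
    have t3 : |(e₀ - e₁) ^ 2| ≤ (v * s) ^ 2 := by rw [abs_pow]; exact pow_le_pow_left₀ (abs_nonneg _) hm 2
    have := abs_add_three (2 * e₁ * (e₂ - 2 * e₁ + e₀)) ((e₂ - e₁) ^ 2) ((e₀ - e₁) ^ 2)
    linarith
  have hu2 : |(2 * e₁ * (e₂ - 2 * e₁ + e₀) + (e₂ - e₁) ^ 2 + (e₀ - e₁) ^ 2) / Λ ^ 2| ≤ (2 * E * (κ * s ^ 2) + 2 * (v * s) ^ 2) / Λ ^ 2 := by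
    rw [abs_div, abs_of_nonneg (sq_nonneg Λ)]
    exact div_le_div_of_nonneg_right hnum (sq_nonneg _)
  have hsqp : ((e₂ - e₁) * (e₂ + e₁) / Λ ^ 2) ^ 2 ≤ (v * s * (2 * E) / Λ ^ 2) ^ 2 := by
    rw [← sq_abs]; exact pow_le_pow_left₀ (abs_nonneg _) hup 2
  have hsqm : ((e₀ - e₁) * (e₀ + e₁) / Λ ^ 2) ^ 2 ≤ (v * s * (2 * E) / Λ ^ 2) ^ 2 := by
    rw [← sq_abs]; exact pow_le_pow_left₀ (abs_nonneg _) hum 2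
  have hmain := abs_hubbardCutoffWeightCT_secondDiff_le β μ K Λ ν p Q
  have hid : 8 / 3 * ((2 * E * (κ * s ^ 2) + 2 * (v * s) ^ 2) / Λ ^ 2) + 176 / 9 * ((v * s * (2 * E) / Λ ^ 2) ^ 2 + (v * s * (2 * E) / Λ ^ 2) ^ 2) =
      (16 / 3 * (E * κ + v ^ 2) / Λ ^ 2 + 1408 / 9 * E ^ 2 * v ^ 2 / Λ ^ 4) * s ^ 2 := by ring
  rw [← hid]
  refine hmain.trans (add_le_add ?_ ?_)
  · exact mul_le_mul_of_nonneg_left hu2 (by norm_num)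
  · exact mul_le_mul_of_nonneg_left (add_le_add hsqp hsqm) (by norm_num)

/-! ## §3 A weighted rung `φ·ĝ_K` with abstract profile sizes -/

/-- **Second difference of a weighted rung, closed form**: with rung sizes `‖ĝ(ν,p′)‖ ≤ g` (`p′ = p−Q, p, p+Q`) and profile sizes `|φ(ν,p−Q)| ≤ Φ₀`,
`|φ(ν,p) − φ(ν,p−Q)| ≤ Φ₁`, `|δ²_Qφ(ν,p)| ≤ Φ₂`:
`‖δ²_Q(φĝ)(ν,p)‖ ≤ Φ₂·g + 2·Φ₁·((4 + coeffNorm 1 K)·s)·g² + Φ₀·((4 + coeffNorm 2 K) + 2(4 + coeffNorm 1 K)²·g)·g²·s²`, `s = |p_Q|_𝕋`. [folklore] -/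
theorem klrj_norm_weightedRung_secondDiff_le (hβ : β ≠ 0) (φ : FreqMomentum L M → ℝ) (ν : MatsubaraIdx M) (p Q : TorusSite 2 L)
    {g Φ₀ Φ₁ Φ₂ : ℝ} (hgp : ‖propCT L M β μ K (ν, p + Q)‖ ≤ g) (hg : ‖propCT L M β μ K (ν, p)‖ ≤ g) (hgm : ‖propCT L M β μ K (ν, p - Q)‖ ≤ g)
    (h0 : |φ (ν, p - Q)| ≤ Φ₀) (h1 : |φ (ν, p) - φ (ν, p - Q)| ≤ Φ₁) (h2 : |φ (ν, p + Q) - 2 * φ (ν, p) + φ (ν, p - Q)| ≤ Φ₂) :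
    ‖(φ (ν, p + Q) : ℂ) * propCT L M β μ K (ν, p + Q) - 2 * ((φ (ν, p) : ℂ) * propCT L M β μ K (ν, p)) +
        (φ (ν, p - Q) : ℂ) * propCT L M β μ K (ν, p - Q)‖ ≤
      Φ₂ * g + 2 * (Φ₁ * ((4 + K.coeffNorm 1) * klTorusNorm L Q * g ^ 2)) +
        Φ₀ * (((4 + K.coeffNorm 2) + 2 * (4 + K.coeffNorm 1) ^ 2 * g) * g ^ 2 * klTorusNorm L Q ^ 2) := by
  have hg0 : 0 ≤ g := (norm_nonneg _).trans hg
  have hΦ₀ : 0 ≤ Φ₀ := (abs_nonneg _).trans h0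
  have hΦ₁ : 0 ≤ Φ₁ := (abs_nonneg _).trans h1
  have hΦ₂ : 0 ≤ Φ₂ := (abs_nonneg _).trans h2
  have hvs : 0 ≤ (4 + K.coeffNorm 1) * klTorusNorm L Q :=
    mul_nonneg (by have := TrigPolyC4v.coeffNorm_nonneg 1 K; linarith) (EngineV8.klband_klTorusNorm_nonneg (L := L) Q)
  have hd := klbj_abs_nambuXiCT_add_sub_le μ K p Q
  have hdd := klrj_norm_propCT_secondDiff_le_of_size β μ K hβ ν p Q hgp hg hgm
  refine (norm_weightedRung_secondDiff_le μ K hβ φ ν p Q).trans (add_le_add_three ?_ ?_ ?_)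
  · exact mul_le_mul h2 hgp (norm_nonneg _) hΦ₂
  · refine mul_le_mul_of_nonneg_left ?_ (by norm_num)
    have hgg : ‖propCT L M β μ K (ν, p + Q)‖ * ‖propCT L M β μ K (ν, p)‖ ≤ g ^ 2 := by
      rw [sq]; exact mul_le_mul hgp hg (norm_nonneg _) hg0
    exact mul_le_mul h1 (mul_le_mul hd hgg (by positivity) hvs) (by positivity) hΦ₁
  · exact mul_le_mul h0 hdd (norm_nonneg _) hΦ₀

/-! ## §4 The hard-shell member `φ = w^K_Λ`: one closed form in `E, Λ, g` and the frame weights -/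

omit [NeZero L] in
/-- `0 ≤ w^K_Λ ≤ 1`, hence `|w^K_Λ(k)| ≤ 1`. [folklore] -/
theorem klrj_abs_cutoffWeight_le_one (Λ : ℝ) (k : FreqMomentum L M) : |hubbardCutoffWeightCT L M β μ K Λ k| ≤ 1 := by
  obtain ⟨h0, h1⟩ := salmhoferCutoff_mem_Icc ((matsubaraFreq β M k.1 ^ 2 + nambuXiCT L μ K k.2 ^ 2) / Λ ^ 2)
  unfold hubbardCutoffWeightCT
  rw [abs_of_nonneg h0]; exact h1

/-- **Second difference of the hard-shell weighted rung `w_Λ·ĝ_K`, closed form**: rung sizes `‖ĝ(ν,p′)‖ ≤ g` and band sizes `|e_K(p′)| ≤ E` at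
`p′ = p−Q, p, p+Q` ⟹ `‖δ²_Q(w_Λĝ)(ν,p)‖ ≤ C·|p_Q|_𝕋²`,
`C = ((16/3)(Eκ + v²)/Λ² + (1408/9)E²v²/Λ⁴)·g + 2·((8/3)(v·2E/Λ²))·v·g² + (κ + 2v²g)·g²` (`v = 4 + coeffNorm 1 K`, `κ = 4 + coeffNorm 2 K`). [folklore] -/
theorem klrj_norm_cutoffWeightedRung_secondDiff_le (hβ : β ≠ 0) (Λ : ℝ) (ν : MatsubaraIdx M) (p Q : TorusSite 2 L) {g E : ℝ}
    (hgp : ‖propCT L M β μ K (ν, p + Q)‖ ≤ g) (hg : ‖propCT L M β μ K (ν, p)‖ ≤ g) (hgm : ‖propCT L M β μ K (ν, p - Q)‖ ≤ g)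
    (hEp : |nambuXiCT L μ K (p + Q)| ≤ E) (hE : |nambuXiCT L μ K p| ≤ E) (hEm : |nambuXiCT L μ K (p - Q)| ≤ E) :
    ‖(hubbardCutoffWeightCT L M β μ K Λ (ν, p + Q) : ℂ) * propCT L M β μ K (ν, p + Q) -
          2 * ((hubbardCutoffWeightCT L M β μ K Λ (ν, p) : ℂ) * propCT L M β μ K (ν, p)) +
        (hubbardCutoffWeightCT L M β μ K Λ (ν, p - Q) : ℂ) * propCT L M β μ K (ν, p - Q)‖ ≤
      ((16 / 3 * (E * (4 + K.coeffNorm 2) + (4 + K.coeffNorm 1) ^ 2) / Λ ^ 2 + 1408 / 9 * E ^ 2 * (4 + K.coeffNorm 1) ^ 2 / Λ ^ 4) * g +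
            2 * (8 / 3 * ((4 + K.coeffNorm 1) * (2 * E) / Λ ^ 2)) * (4 + K.coeffNorm 1) * g ^ 2 +
          ((4 + K.coeffNorm 2) + 2 * (4 + K.coeffNorm 1) ^ 2 * g) * g ^ 2) *
        klTorusNorm L Q ^ 2 := by
  have h := klrj_norm_weightedRung_secondDiff_le β μ K hβ (hubbardCutoffWeightCT L M β μ K Λ) ν p Q hgp hg hgm
    (klrj_abs_cutoffWeight_le_one β μ K Λ (ν, p - Q)) (klrj_abs_cutoffWeight_sub_le' β μ K Λ ν p Q hE hEm)
    (klrj_abs_cutoffWeight_secondDiff_le β μ K Λ ν p Q hEp hE hEm)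
  refine h.trans (le_of_eq ?_)
  ring

/-! ## §5 The complementary member `φ = softSymbolCompl … n m = w_{Λ_m} − w_{Λ_n}`: the same, summed over the two scales -/

omit [NeZero L] in
/-- `|w_{Λ_m}(k) − w_{Λ_n}(k)| ≤ 1` (both weights lie in `[0, 1]`). [folklore] -/
theorem klrj_abs_softSymbolCompl_le_one [NeZero M] (n m : ℕ) (k : FreqMomentum L M) : |softSymbolCompl L M β μ K n m k| ≤ 1 := by
  obtain ⟨a0, a1⟩ := salmhoferCutoff_mem_Icc ((matsubaraFreq β M k.1 ^ 2 + nambuXiCT L μ K k.2 ^ 2) / klScale klE0 m ^ 2)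
  obtain ⟨b0, b1⟩ := salmhoferCutoff_mem_Icc ((matsubaraFreq β M k.1 ^ 2 + nambuXiCT L μ K k.2 ^ 2) / klScale klE0 n ^ 2)
  unfold softSymbolCompl hubbardCutoffWeightCT
  rw [abs_le]; constructor <;> linarith

/-- **First difference of the complementary member, backward**: `|e_K(p)|, |e_K(p−Q)| ≤ E` ⟹
`|φ(ν,p) − φ(ν,p−Q)| ≤ (8/3)(v·s·2E)/Λ_m² + (8/3)(v·s·2E)/Λ_n²` (`φ = w_{Λ_m} − w_{Λ_n}`). [folklore] -/
theorem klrj_abs_softSymbolCompl_sub_le' [NeZero M] (n m : ℕ) (ν : MatsubaraIdx M) (p Q : TorusSite 2 L) {E : ℝ} (hE : |nambuXiCT L μ K p| ≤ E)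
    (hEm : |nambuXiCT L μ K (p - Q)| ≤ E) :
    |softSymbolCompl L M β μ K n m (ν, p) - softSymbolCompl L M β μ K n m (ν, p - Q)| ≤
      8 / 3 * ((4 + K.coeffNorm 1) * klTorusNorm L Q * (2 * E) / klScale klE0 m ^ 2) +
        8 / 3 * ((4 + K.coeffNorm 1) * klTorusNorm L Q * (2 * E) / klScale klE0 n ^ 2) := by
  have hm := klrj_abs_cutoffWeight_sub_le' β μ K (klScale klE0 m) ν p Q hE hEm
  have hn := klrj_abs_cutoffWeight_sub_le' β μ K (klScale klE0 n) ν p Q hE hEm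
  simp only [softSymbolCompl]
  rw [show hubbardCutoffWeightCT L M β μ K (klScale klE0 m) (ν, p) - hubbardCutoffWeightCT L M β μ K (klScale klE0 n) (ν, p) -
      (hubbardCutoffWeightCT L M β μ K (klScale klE0 m) (ν, p - Q) - hubbardCutoffWeightCT L M β μ K (klScale klE0 n) (ν, p - Q)) =
      (hubbardCutoffWeightCT L M β μ K (klScale klE0 m) (ν, p) - hubbardCutoffWeightCT L M β μ K (klScale klE0 m) (ν, p - Q)) -
        (hubbardCutoffWeightCT L M β μ K (klScale klE0 n) (ν, p) - hubbardCutoffWeightCT L M β μ K (klScale klE0 n) (ν, p - Q)) by ring]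
  exact (abs_sub _ _).trans (add_le_add hm hn)

/-- **Second difference of the complementary member**: `|e_K| ≤ E` at `p−Q, p, p+Q` ⟹ `|δ²_Qφ(ν,p)| ≤ (C₂(Λ_m) + C₂(Λ_n))·s²`,
`C₂(Λ) = (16/3)(Eκ + v²)/Λ² + (1408/9)E²v²/Λ⁴` (`φ = w_{Λ_m} − w_{Λ_n}`). [folklore] -/
theorem klrj_abs_softSymbolCompl_secondDiff_le [NeZero M] (n m : ℕ) (ν : MatsubaraIdx M) (p Q : TorusSite 2 L) {E : ℝ}
    (hEp : |nambuXiCT L μ K (p + Q)| ≤ E) (hE : |nambuXiCT L μ K p| ≤ E) (hEm : |nambuXiCT L μ K (p - Q)| ≤ E) :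
    |softSymbolCompl L M β μ K n m (ν, p + Q) - 2 * softSymbolCompl L M β μ K n m (ν, p) + softSymbolCompl L M β μ K n m (ν, p - Q)| ≤
      ((16 / 3 * (E * (4 + K.coeffNorm 2) + (4 + K.coeffNorm 1) ^ 2) / klScale klE0 m ^ 2 +
            1408 / 9 * E ^ 2 * (4 + K.coeffNorm 1) ^ 2 / klScale klE0 m ^ 4) +
          (16 / 3 * (E * (4 + K.coeffNorm 2) + (4 + K.coeffNorm 1) ^ 2) / klScale klE0 n ^ 2 +
            1408 / 9 * E ^ 2 * (4 + K.coeffNorm 1) ^ 2 / klScale klE0 n ^ 4)) * klTorusNorm L Q ^ 2 := by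
  have hm := klrj_abs_cutoffWeight_secondDiff_le β μ K (klScale klE0 m) ν p Q hEp hE hEm
  have hn := klrj_abs_cutoffWeight_secondDiff_le β μ K (klScale klE0 n) ν p Q hEp hE hEm
  refine (abs_softSymbolCompl_secondDiff_le β μ K n m ν p Q).trans ?_
  rw [add_mul]
  exact add_le_add hm hn

/-- **Second difference of the complementary weighted rung `(w_{Λ_m} − w_{Λ_n})·ĝ_K`, closed form**: rung sizes `‖ĝ(ν,p′)‖ ≤ g` and band sizes
`|e_K(p′)| ≤ E` at `p′ = p−Q, p, p+Q` ⟹ `‖δ²_Q(φĝ)(ν,p)‖ ≤ (C(Λ_m-part) + C(Λ_n-part) + (κ + 2v²g)g²)·|p_Q|_𝕋²` — the §4 shape with the `Λ`-dependent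
terms summed over the two scales. [folklore] -/
theorem klrj_norm_softWeightedRung_secondDiff_le [NeZero M] (hβ : β ≠ 0) (n m : ℕ) (ν : MatsubaraIdx M) (p Q : TorusSite 2 L) {g E : ℝ}
    (hgp : ‖propCT L M β μ K (ν, p + Q)‖ ≤ g) (hg : ‖propCT L M β μ K (ν, p)‖ ≤ g) (hgm : ‖propCT L M β μ K (ν, p - Q)‖ ≤ g)
    (hEp : |nambuXiCT L μ K (p + Q)| ≤ E) (hE : |nambuXiCT L μ K p| ≤ E) (hEm : |nambuXiCT L μ K (p - Q)| ≤ E) :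
    ‖(softSymbolCompl L M β μ K n m (ν, p + Q) : ℂ) * propCT L M β μ K (ν, p + Q) -
          2 * ((softSymbolCompl L M β μ K n m (ν, p) : ℂ) * propCT L M β μ K (ν, p)) +
        (softSymbolCompl L M β μ K n m (ν, p - Q) : ℂ) * propCT L M β μ K (ν, p - Q)‖ ≤
      (((16 / 3 * (E * (4 + K.coeffNorm 2) + (4 + K.coeffNorm 1) ^ 2) / klScale klE0 m ^ 2 +
              1408 / 9 * E ^ 2 * (4 + K.coeffNorm 1) ^ 2 / klScale klE0 m ^ 4) +
            (16 / 3 * (E * (4 + K.coeffNorm 2) + (4 + K.coeffNorm 1) ^ 2) / klScale klE0 n ^ 2 +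
              1408 / 9 * E ^ 2 * (4 + K.coeffNorm 1) ^ 2 / klScale klE0 n ^ 4)) * g +
          2 * (8 / 3 * ((4 + K.coeffNorm 1) * (2 * E) / klScale klE0 m ^ 2) + 8 / 3 * ((4 + K.coeffNorm 1) * (2 * E) / klScale klE0 n ^ 2)) *
            (4 + K.coeffNorm 1) * g ^ 2 +
          ((4 + K.coeffNorm 2) + 2 * (4 + K.coeffNorm 1) ^ 2 * g) * g ^ 2) * klTorusNorm L Q ^ 2 := by
  have h := klrj_norm_weightedRung_secondDiff_le β μ K hβ (softSymbolCompl L M β μ K n m) ν p Q hgp hg hgm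
    (klrj_abs_softSymbolCompl_le_one β μ K n m (ν, p - Q)) (klrj_abs_softSymbolCompl_sub_le' β μ K n m ν p Q hE hEm)
    (klrj_abs_softSymbolCompl_secondDiff_le β μ K n m ν p Q hEp hE hEm)
  refine h.trans (le_of_eq ?_)
  ring

end Composed

end Summit.HubbardSuperconductivity.HubbardSuperconductivity.Theorems.KLRegimeSplit

end
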